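import Mathlib
import Summits.QuantumAdvantage.QuantumAdvantage.Theorems.MobiusLadderQuadraticDigitPhasesStubCompactLemmas
import Summits.QuantumAdvantage.QuantumAdvantage.Theorems.MobiusLadderQuadraticDigitPhasesLowCutKataiCases
import Literature.Computability.AlgebraicComplexity.SecondFundamentalTheoremGL

/-!
# Sequential far pairs from non-lowness (stub `stub_structureA`)

The stub `stub_structureA` of the crux `MobiusLadder.QuadraticDigitPhases`
(stmt-QuantumAdvantage-1391), line `Sketch`, with its lemmas.

`P` is a quadratic form in the binary digits `x_0, …, x_{n-1}` over `𝔽₂`; `c_{ij} = coeff (X_i X_j) P`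
(`i < j`) means "digit `i` is read at position `j`"; the cut matrix at `c` keeps the entries with
`i < c ≤ j`, and all cut ranks are `< R₀`.  A *far entry* is a pair `i < j < n` with `j - i > s` and
`c_{ij} ≠ 0`.  `P` is `(R,s)`-low if it agrees everywhere with an `s`-banded quadratic `Q` plus fewer
than `R` products of two linear forms.
* `exists_scan`: the GREEDY SCAN.  `k_t` is the least target of a far entry with source `≥ k_{t-1}`
  (`k_{-1} = 0`), `b_t` a witness source; it stops after `g` steps when no far entry has its source
  beyond the last cut.  Every far entry `(b', k')` then crosses a cut: `k_{t-1} ≤ b' < k_t ≤ k'`.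
* `low_of_cover`: if every far entry crosses one of `g` such cuts, then `P` is an `s`-banded `Q` plus
  `g (R₀ - 1)` products: the far entries split into `g` blocks (rows `[k_{t-1}, k_t)`, columns
  `[k_t, n)`), each a row truncation of a cut matrix, of rank `≤ R₀ - 1`, hence a sum of `R₀ - 1`
  products of linear forms (rank factorisation, `exists_eq_mul_of_rank_le` from
  `Literature/Computability/AlgebraicComplexity/SecondFundamentalTheoremGL`).
* `stub_structureA`: so if `P` is not `(R,s)`-low, then `R ≤ R₀ g`.

Mathlib + the landed siblings `…StubCompactLemmas` (`single_add_eq_single_add_iff`),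
`…LowCutKataiCases` (`monomial_eq_of_two_mem`) and the Literature rank factorisation.
-/

set_option linter.dupNamespace false -- D-0017: single-problem summit ⇒ `QuantumAdvantage.QuantumAdvantage` by design

namespace Summit.QuantumAdvantage.QuantumAdvantage.Theorems.MobiusLadderQuadraticDigitPhasesStubStructureA

open Finset MvPolynomial
open Summit.QuantumAdvantage.QuantumAdvantage.Theorems.MobiusLadderQuadraticDigitPhasesStubCompact
  (single_add_eq_single_add_iff)
open Summit.QuantumAdvantage.QuantumAdvantage.Theorems.MobiusLadderQuadraticDigitPhasesLowCutKataiCases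
  (monomial_eq_of_two_mem)
open Literature.Computability.AlgebraicComplexity (exists_eq_mul_of_rank_le)

/-- **Greedy scan** for an abstract "far entry" relation `F i j` (`i < j`, sources `i < n`).  There are
thresholds `θ 0 = 0`, `θ (t+1) = k t`, witnesses `b t` and a length `g` such that, for `t < g`,
`(b t, k t)` is an entry with source `≥ θ t` and `k t` is the least target of such an entry; the cuts
are disjoint (`k t ≤ θ t'` for `t < t' < g`); and every entry `(i, j)` has its source in some row band
`θ t ≤ i < k t`, `t < g` (so that `k t ≤ j` by minimality). -/
theorem exists_scan {n : ℕ} (F : ℕ → ℕ → Prop) (hF : ∀ i j, F i j → i < j ∧ i < n) :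
    ∃ (g : ℕ) (θ b k : ℕ → ℕ), θ 0 = 0 ∧ (∀ t, θ (t + 1) = k t) ∧
      (∀ t, t < g → θ t ≤ b t ∧ F (b t) (k t)) ∧
      (∀ t, t < g → ∀ i j, θ t ≤ i → F i j → k t ≤ j) ∧
      (∀ t t', t < t' → t' < g → k t ≤ θ t') ∧
      (∀ i j, F i j → ∃ t, t < g ∧ θ t ≤ i ∧ i < k t) := by
  classical
  -- one greedy step from the threshold `θ₀`: the least target `κ θ₀` and a witness source `β θ₀`
  have hstep : ∀ θ₀ : ℕ, ∃ κ β : ℕ, (∃ j i, θ₀ ≤ i ∧ F i j) →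
      θ₀ ≤ β ∧ F β κ ∧ ∀ i j, θ₀ ≤ i → F i j → κ ≤ j := by
    intro θ₀
    by_cases h : ∃ j i, θ₀ ≤ i ∧ F i j
    · obtain ⟨i, hi, hFi⟩ := Nat.find_spec h
      exact ⟨Nat.find h, i, fun _ => ⟨hi, hFi, fun i' j' hi' hF' => Nat.find_min' h ⟨i', hi', hF'⟩⟩⟩
    · exact ⟨0, 0, fun h' => absurd h' h⟩
  choose κ β hκβ using hstep
  -- thresholds `θ t = κ^[t] 0`
  obtain ⟨θ, hθ0, hθs⟩ : ∃ θ : ℕ → ℕ, θ 0 = 0 ∧ ∀ t, θ (t + 1) = κ (θ t) :=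
    ⟨fun t => κ^[t] 0, rfl, fun t => Function.iterate_succ_apply' κ t 0⟩
  -- the scan stops
  have hstop : ∃ t, ¬ ∃ j i, θ t ≤ i ∧ F i j := by
    by_contra hall
    have hall' : ∀ t, ∃ j i, θ t ≤ i ∧ F i j := fun t => not_not.mp (not_exists.mp hall t)
    have hgrow : ∀ t, t ≤ θ t := by
      intro t
      induction t with
      | zero => exact Nat.zero_le _
      | succ t ih =>
        obtain ⟨hb, hFb, -⟩ := hκβ (θ t) (hall' t)
        have h1 := (hF _ _ hFb).1
        rw [hθs]
        omega
    obtain ⟨j, i, hi, hFi⟩ := hall' n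
    have h1 := (hF i j hFi).2
    have h2 := hgrow n
    omega
  have hlive : ∀ t, t < Nat.find hstop → ∃ j i, θ t ≤ i ∧ F i j := fun t ht =>
    not_not.mp (Nat.find_min hstop ht)
  -- `θ` is monotone up to the stopping time
  have hmono : ∀ d u, u + d ≤ Nat.find hstop → θ u ≤ θ (u + d) := by
    intro d
    induction d with
    | zero => intro u _; simp
    | succ d ih =>
      intro u hud
      have h1 := ih u (by omega)
      obtain ⟨hb, hFb, -⟩ := hκβ (θ (u + d)) (hlive (u + d) (by omega))
      have h2 := (hF _ _ hFb).1
      have h3 : θ (u + (d + 1)) = κ (θ (u + d)) := by rw [← add_assoc, hθs]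
      rw [h3]
      omega
  refine ⟨Nat.find hstop, θ, fun t => β (θ t), fun t => κ (θ t), hθ0, hθs,
    fun t ht => ⟨(hκβ _ (hlive t ht)).1, (hκβ _ (hlive t ht)).2.1⟩,
    fun t _ i j hi hFij => (hκβ _ ⟨j, i, hi, hFij⟩).2.2 i j hi hFij,
    fun t t' htt' ht' => ?_, fun i j hFij => ?_⟩
  · -- disjointness: `k t = θ (t + 1) ≤ θ t'`
    show κ (θ t) ≤ θ t'
    rw [← hθs]
    have := hmono (t' - (t + 1)) (t + 1) (by omega)
    rwa [show t + 1 + (t' - (t + 1)) = t' by omega] at this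
  · -- covering: the first threshold beyond `i` is some `θ (t + 1) = k t` with `t < g`
    have hbeyond : i < θ (Nat.find hstop) :=
      not_le.mp fun hle => Nat.find_spec hstop ⟨j, i, hle, hFij⟩
    have hpos : ∃ t, i < θ t := ⟨_, hbeyond⟩
    have hle : Nat.find hpos ≤ Nat.find hstop := Nat.find_min' hpos hbeyond
    have h0 : Nat.find hpos ≠ 0 := fun h0 => by
      have := Nat.find_spec hpos
      exact Nat.not_lt_zero i (by rwa [h0, hθ0] at this)
    obtain ⟨t, ht⟩ := Nat.exists_eq_succ_of_ne_zero h0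
    refine ⟨t, by omega, not_lt.mp (Nat.find_min hpos (by omega)), ?_⟩
    have := Nat.find_spec hpos
    rwa [ht, hθs] at this

section PairSums

variable {K : Type*} [CommSemiring K]

/-- `eval x (c X_i X_j) = c xᵢ xⱼ`. -/
theorem eval_monomial_pair {σ : Type*} (x : σ → K) (i j : σ) (c : K) :
    eval x (monomial (Finsupp.single i 1 + Finsupp.single j 1) c) = c * x i * x j := by
  rw [monomial_single_add, ← C_mul_X_pow_eq_monomial]
  simp only [map_mul, eval_X, eval_C, pow_one]
  ring

/-- A factorisation `M i j = Σ_s u_s i v_s j` turns the bilinear form of `M` into a sum of products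
of linear forms. -/
theorem sum_bilinear_factor {n ρ : ℕ} (M : Fin n → Fin n → K) (u v : Fin ρ → Fin n → K)
    (h : ∀ i j, M i j = ∑ s, u s i * v s j) (x : Fin n → K) :
    ∑ i, ∑ j, M i j * x i * x j = ∑ s, (∑ i, u s i * x i) * (∑ i, v s i * x i) := by
  calc ∑ i, ∑ j, M i j * x i * x j
      = ∑ i, ∑ j, ∑ s, u s i * x i * (v s j * x j) := by
        refine Finset.sum_congr rfl fun i _ => Finset.sum_congr rfl fun j _ => ?_
        rw [h, Finset.sum_mul, Finset.sum_mul]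
        exact Finset.sum_congr rfl fun s _ => by ring
    _ = ∑ i, ∑ s, ∑ j, u s i * x i * (v s j * x j) :=
        Finset.sum_congr rfl fun i _ => Finset.sum_comm
    _ = ∑ s, ∑ i, ∑ j, u s i * x i * (v s j * x j) := Finset.sum_comm
    _ = ∑ s, (∑ i, u s i * x i) * (∑ i, v s i * x i) :=
        Finset.sum_congr rfl fun s _ => by rw [Finset.sum_mul_sum]

/-- Re-indexing a double family of summands by `Fin (g ρ)`. -/
theorem sum_finProdFinEquiv {M : Type*} [AddCommMonoid M] {g ρ : ℕ} (F : Fin g → Fin ρ → M) :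
    ∑ r : Fin (g * ρ), F (finProdFinEquiv.symm r).1 (finProdFinEquiv.symm r).2 =
      ∑ t, ∑ s, F t s := by
  rw [← Fintype.sum_prod_type']
  exact Equiv.sum_comp finProdFinEquiv.symm (fun p => F p.1 p.2)

/-- The coefficient of `X_a X_b`, `a < b`, in `Σ_{i,j} N i j X_i X_j` is `N a b` when `N` is
supported on `i < j`. -/
theorem coeff_pair_sum_monomial {n : ℕ} (N : Fin n → Fin n → K) (hN : ∀ i j, N i j ≠ 0 → i < j)
    {a b : Fin n} (hab : a < b) :
    coeff (Finsupp.single a 1 + Finsupp.single b 1)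
      (∑ i : Fin n, ∑ j : Fin n, monomial (Finsupp.single i 1 + Finsupp.single j 1) (N i j)) =
      N a b := by
  classical
  simp only [coeff_sum, coeff_monomial]
  have key : ∀ i j : Fin n, i ≠ a ∨ j ≠ b →
      (if Finsupp.single i 1 + Finsupp.single j 1 = Finsupp.single a 1 + Finsupp.single b 1
        then N i j else 0) = 0 := by
    intro i j hij
    split_ifs with h
    · by_contra hne
      obtain ⟨rfl, rfl⟩ := (single_add_eq_single_add_iff (hN i j hne) hab).mp h
      simp at hij
    · rfl
  rw [Finset.sum_eq_single_of_mem a (Finset.mem_univ _) fun i _ hia =>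
    Finset.sum_eq_zero fun j _ => key i j (Or.inl hia)]
  rw [Finset.sum_eq_single_of_mem b (Finset.mem_univ _) fun j _ hjb => key a j (Or.inr hjb)]
  rw [if_pos rfl]

/-- A sum of pair monomials has total degree `≤ 2`. -/
theorem totalDegree_sum_pair_le {n : ℕ} {ι : Type*} (T : Finset ι) (N : ι → Fin n → Fin n → K) :
    (∑ t ∈ T, ∑ i : Fin n, ∑ j : Fin n,
      monomial (Finsupp.single i 1 + Finsupp.single j 1) (N t i j)).totalDegree ≤ 2 := by
  refine totalDegree_finsetSum_le fun t _ => totalDegree_finsetSum_le fun i _ =>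
    totalDegree_finsetSum_le fun j _ => (totalDegree_monomial_le _ _).trans (le_of_eq ?_)
  rw [Finsupp.sum_add_index' (fun _ => rfl) (fun _ _ _ => rfl), Finsupp.sum_single_index rfl,
    Finsupp.sum_single_index rfl]
  rfl

end PairSums

/-- **Decomposition.**  If all cut ranks of `P` are `< R₀` and every far entry `(a, b)` (`a < b`,
`b - a > s`, `coeff (X_a X_b) P ≠ 0`) crosses one of `g` disjoint cuts, `θ t ≤ a < k t ≤ b`, then
`P` agrees on all points with an `s`-banded quadratic `Q` plus `g (R₀ - 1)` products of linear
forms: block `t` (rows `[θ t, k t)`, columns `[k t, n)`) of the coefficient array is a row truncation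
of the cut matrix at `k t`, so has rank `≤ R₀ - 1` and is a sum of `R₀ - 1` products
(`exists_eq_mul_of_rank_le`); `Q` is `P` minus the blocks. -/
theorem low_of_cover {n R₀ s g : ℕ} {P : MvPolynomial (Fin n) (ZMod 2)} (hP : P.totalDegree ≤ 2)
    (hcut : ∀ c : ℕ, (Matrix.of fun (i j : Fin n) => if (i : ℕ) < c ∧ c ≤ (j : ℕ) then
      MvPolynomial.coeff (Finsupp.single i 1 + Finsupp.single j 1) P else 0).rank < R₀)
    (θ k : ℕ → ℕ) (hdisj : ∀ t t', t < t' → t' < g → k t ≤ θ t')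
    (hcover : ∀ a b : Fin n, (a : ℕ) < b → s < (b : ℕ) - a →
      MvPolynomial.coeff (Finsupp.single a 1 + Finsupp.single b 1) P ≠ 0 →
      ∃ t, t < g ∧ θ t ≤ a ∧ (a : ℕ) < k t ∧ k t ≤ b) :
    ∃ Q : MvPolynomial (Fin n) (ZMod 2), Q.totalDegree ≤ 2 ∧
      (∀ m ∈ Q.support, ∀ i ∈ m.support, ∀ j ∈ m.support, Nat.dist i j ≤ s) ∧
      ∃ u v : Fin (g * (R₀ - 1)) → Fin n → ZMod 2, ∀ x : Fin n → ZMod 2,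
        MvPolynomial.eval x P = MvPolynomial.eval x Q +
          ∑ r : Fin (g * (R₀ - 1)), (∑ i : Fin n, u r i * x i) * (∑ i : Fin n, v r i * x i) := by
  classical
  -- the blocks
  obtain ⟨A, hA⟩ : ∃ A : ℕ → Matrix (Fin n) (Fin n) (ZMod 2), ∀ t i j, A t i j =
      if θ t ≤ (i : ℕ) ∧ (i : ℕ) < k t ∧ k t ≤ (j : ℕ) then
        MvPolynomial.coeff (Finsupp.single i 1 + Finsupp.single j 1) P else 0 :=
    ⟨fun t => Matrix.of fun i j => if θ t ≤ (i : ℕ) ∧ (i : ℕ) < k t ∧ k t ≤ (j : ℕ) then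
        MvPolynomial.coeff (Finsupp.single i 1 + Finsupp.single j 1) P else 0, fun _ _ _ => rfl⟩
  have hAlt : ∀ t i j, A t i j ≠ 0 → i < j := by
    intro t i j hne
    rw [hA] at hne
    by_contra hij
    refine hne (if_neg ?_)
    rintro ⟨-, h1, h2⟩
    exact hij (Fin.lt_def.mpr (by omega))
  -- block `t` is a row truncation of the cut matrix at `k t`
  have hrank : ∀ t, (A t).rank ≤ R₀ - 1 := by
    intro t
    set D : Matrix (Fin n) (Fin n) (ZMod 2) :=
      Matrix.diagonal fun i => if θ t ≤ (i : ℕ) then 1 else 0 with hD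
    set M : Matrix (Fin n) (Fin n) (ZMod 2) := Matrix.of fun i j =>
      if (i : ℕ) < k t ∧ k t ≤ (j : ℕ) then
        MvPolynomial.coeff (Finsupp.single i 1 + Finsupp.single j 1) P else 0 with hM
    have hfac : A t = D * M := by
      ext i j
      rw [hA, hD, Matrix.diagonal_mul, hM, Matrix.of_apply]
      by_cases h1 : θ t ≤ (i : ℕ)
      · by_cases h2 : (i : ℕ) < k t ∧ k t ≤ (j : ℕ)
        · rw [if_pos ⟨h1, h2⟩, if_pos h1, if_pos h2, one_mul]
        · rw [if_neg fun h => h2 h.2, if_neg h2, mul_zero]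
      · rw [if_neg fun h => h1 h.1, if_neg h1, zero_mul]
    have h1 : (A t).rank ≤ M.rank := hfac ▸ Matrix.rank_mul_le_right D M
    have h2 : M.rank < R₀ := hcut (k t)
    omega
  -- rank factorisation of the blocks
  have hfact : ∀ t : Fin g, ∃ u v : Fin (R₀ - 1) → Fin n → ZMod 2,
      ∀ i j, A t i j = ∑ s, u s i * v s j := by
    intro t
    obtain ⟨U, W, hUW⟩ := exists_eq_mul_of_rank_le (A t) (hrank t)
    exact ⟨fun s i => U i s, fun s j => W s j, fun i j => by rw [hUW, Matrix.mul_apply]⟩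
  choose u v huv using hfact
  -- the correction polynomial: the blocks
  obtain ⟨B, hB⟩ : ∃ B : MvPolynomial (Fin n) (ZMod 2), B = ∑ t : Fin g, ∑ i : Fin n, ∑ j : Fin n,
      monomial (Finsupp.single i 1 + Finsupp.single j 1) (A t i j) := ⟨_, rfl⟩
  have hBdeg : B.totalDegree ≤ 2 := hB ▸ totalDegree_sum_pair_le _ _
  have hQdeg : (P - B).totalDegree ≤ 2 := (totalDegree_sub P B).trans (max_le hP hBdeg)
  -- pair coefficients of `B`
  have hcoeffB : ∀ a b : Fin n, a < b →
      coeff (Finsupp.single a 1 + Finsupp.single b 1) B = ∑ t : Fin g, A t a b := by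
    intro a b hab
    rw [hB, coeff_sum]
    exact Finset.sum_congr rfl fun t _ => coeff_pair_sum_monomial (fun i j => A t i j) (hAlt t) hab
  -- far coefficients of `Q = P - B` vanish
  have hfarQ : ∀ a b : Fin n, (a : ℕ) < b → s < (b : ℕ) - a →
      coeff (Finsupp.single a 1 + Finsupp.single b 1) (P - B) = 0 := by
    intro a b hab hs
    rw [coeff_sub, hcoeffB a b (Fin.lt_def.mpr hab)]
    by_cases hc : coeff (Finsupp.single a 1 + Finsupp.single b 1) P = 0
    · rw [hc, Finset.sum_eq_zero fun t _ => ?_, sub_zero]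
      rw [hA]
      split_ifs
      · exact hc
      · rfl
    · obtain ⟨t₀, ht₀, h1, h2, h3⟩ := hcover a b hab hs hc
      rw [Finset.sum_eq_single_of_mem (⟨t₀, ht₀⟩ : Fin g) (Finset.mem_univ _) fun t _ hne => ?_]
      · rw [hA, if_pos ⟨h1, h2, h3⟩, sub_self]
      · rw [hA, if_neg]
        rintro ⟨h4, h5, -⟩
        have hne' : (t : ℕ) ≠ t₀ := fun h => hne (Fin.ext h)
        rcases lt_or_gt_of_ne hne' with hlt | hgt
        · have := hdisj t t₀ hlt ht₀
          omega
        · have := hdisj t₀ t hgt t.isLt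
          omega
  -- `Q` is `s`-banded
  have hband : ∀ m ∈ (P - B).support, ∀ i ∈ m.support, ∀ j ∈ m.support, Nat.dist i j ≤ s := by
    intro m hm i hi j hj
    by_contra hfar
    have hij : i ≠ j := by
      rintro rfl
      simp at hfar
    have hc : coeff m (P - B) ≠ 0 := mem_support_iff.mp hm
    rcases lt_or_gt_of_ne hij with hlt | hgt
    · rw [monomial_eq_of_two_mem hQdeg hm hij hi hj] at hc
      refine hc (hfarQ i j (Fin.lt_def.mp hlt) ?_)
      rw [Nat.dist_eq_sub_of_le (Fin.le_def.mp hlt.le)] at hfar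
      omega
    · rw [monomial_eq_of_two_mem hQdeg hm hij.symm hj hi] at hc
      refine hc (hfarQ j i (Fin.lt_def.mp hgt) ?_)
      rw [Nat.dist_comm, Nat.dist_eq_sub_of_le (Fin.le_def.mp hgt.le)] at hfar
      omega
  -- evaluation of the blocks
  have hevalB : ∀ x : Fin n → ZMod 2, eval x B =
      ∑ t : Fin g, ∑ s' : Fin (R₀ - 1), (∑ i, u t s' i * x i) * (∑ i, v t s' i * x i) := by
    intro x
    rw [hB, map_sum]
    refine Finset.sum_congr rfl fun t _ => ?_
    rw [← sum_bilinear_factor (fun i j => A t i j) (u t) (v t) (huv t) x]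
    simp only [map_sum, eval_monomial_pair]
  refine ⟨P - B, hQdeg, hband, fun r => u (finProdFinEquiv.symm r).1 (finProdFinEquiv.symm r).2,
    fun r => v (finProdFinEquiv.symm r).1 (finProdFinEquiv.symm r).2, fun x => ?_⟩
  rw [sum_finProdFinEquiv (fun t s' => (∑ i, u t s' i * x i) * (∑ i, v t s' i * x i)), ← hevalB x,
    map_sub, sub_add_cancel]

/-- **Sequential far pairs from non-lowness** (stub `stub_structureA`).  If all cut ranks of the
quadratic digit phase `P` are `< R₀` and `P` is not `(R,s)`-low, the greedy scan of the far entries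
(`exists_scan`) produces `g` sequential far pairs `b_t < k_t`, `k_t - b_t > s`, `c_{b_t k_t} ≠ 0`,
`k_t ≤ b_{t+1}`, each `k_t` the earliest target of a far entry with source `≥ k_{t-1}`, with
`R ≤ R₀ g`: otherwise the `g` cuts cover all far entries and `low_of_cover` makes `P`
`(R,s)`-low. -/
theorem stub_structureA :
    ∀ (n R₀ R s : ℕ) (P : MvPolynomial (Fin n) (ZMod 2)), P.totalDegree ≤ 2 →
      (∀ c : ℕ, (Matrix.of fun (i j : Fin n) => if (i : ℕ) < c ∧ c ≤ (j : ℕ) then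
          MvPolynomial.coeff (Finsupp.single i 1 + Finsupp.single j 1) P else 0).rank < R₀) →
      ¬ (∃ Q : MvPolynomial (Fin n) (ZMod 2), Q.totalDegree ≤ 2 ∧
          (∀ m ∈ Q.support, ∀ i ∈ m.support, ∀ j ∈ m.support, Nat.dist i j ≤ s) ∧
          ∃ k : ℕ, k < R ∧ ∃ u v : Fin k → Fin n → ZMod 2, ∀ x : Fin n → ZMod 2,
            MvPolynomial.eval x P = MvPolynomial.eval x Q +
              ∑ t : Fin k, (∑ i : Fin n, u t i * x i) * (∑ i : Fin n, v t i * x i)) →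
      ∃ (g : ℕ) (b k : ℕ → ℕ), R ≤ R₀ * g ∧
        (∀ t, t < g → b t < k t ∧ k t < n ∧ s < k t - b t ∧
          ∀ (hb : b t < n) (hk : k t < n), MvPolynomial.coeff (Finsupp.single (⟨b t, hb⟩ : Fin n) 1 + Finsupp.single (⟨k t, hk⟩ : Fin n) 1) P ≠ 0) ∧
        (∀ t, t + 1 < g → k t ≤ b (t + 1)) ∧
        (∀ t, t < g → ∀ b' k' : Fin n, (t = 0 ∨ k (t - 1) ≤ (b' : ℕ)) → (b' : ℕ) < k' → s < (k' : ℕ) - b' →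
          MvPolynomial.coeff (Finsupp.single b' 1 + Finsupp.single k' 1) P ≠ 0 → k t ≤ k') := by
  intro n R₀ R s P hP hcut hnl
  -- far entries on `ℕ × ℕ`
  obtain ⟨F, hF⟩ : ∃ F : ℕ → ℕ → Prop, ∀ i j, F i j ↔ ∃ (hij : i < j) (hjn : j < n), s < j - i ∧
      MvPolynomial.coeff (Finsupp.single (⟨i, hij.trans hjn⟩ : Fin n) 1 +
        Finsupp.single (⟨j, hjn⟩ : Fin n) 1) P ≠ 0 := ⟨_, fun _ _ => Iff.rfl⟩
  have hFlt : ∀ i j, F i j → i < j ∧ i < n := fun i j h => by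
    obtain ⟨hij, hjn, -⟩ := (hF i j).mp h
    exact ⟨hij, hij.trans hjn⟩
  have hFfin : ∀ a c : Fin n, (a : ℕ) < c → s < (c : ℕ) - a →
      MvPolynomial.coeff (Finsupp.single a 1 + Finsupp.single c 1) P ≠ 0 → F a c :=
    fun a c hac hs hc => (hF a c).mpr ⟨hac, c.isLt, hs, hc⟩
  obtain ⟨g, θ, b, k, hθ0, hθs, hS1, hS2, hS4, hS3⟩ := exists_scan F hFlt
  refine ⟨g, b, k, ?_, fun t ht => ?_, fun t ht => ?_, fun t ht b' k' hprev hbk hsk hc => ?_⟩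
  · -- `R ≤ R₀ g`: otherwise `P` is `(R,s)`-low
    by_contra hlt
    obtain ⟨Q, hQ, hband, u, v, huv⟩ := low_of_cover hP hcut θ k hS4 fun a c hac hs hc => by
      obtain ⟨t, ht, h1, h2⟩ := hS3 a c (hFfin a c hac hs hc)
      exact ⟨t, ht, h1, h2, hS2 t ht a c h1 (hFfin a c hac hs hc)⟩
    refine hnl ⟨Q, hQ, hband, g * (R₀ - 1), ?_, u, v, huv⟩
    calc g * (R₀ - 1) ≤ g * R₀ := Nat.mul_le_mul_left g (Nat.sub_le R₀ 1)
      _ = R₀ * g := Nat.mul_comm g R₀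
      _ < R := not_le.mp hlt
  · obtain ⟨hij, hjn, hsd, hc⟩ := (hF _ _).mp (hS1 t ht).2
    exact ⟨hij, hjn, hsd, fun _ _ => hc⟩
  · have := (hS1 (t + 1) ht).1
    rwa [hθs] at this
  · refine hS2 t ht b' k' ?_ (hFfin b' k' hbk hsk hc)
    rcases Nat.eq_zero_or_pos t with rfl | hpos
    · exact hθ0.trans_le (Nat.zero_le _)
    · obtain ⟨t', rfl⟩ := Nat.exists_eq_succ_of_ne_zero hpos.ne'
      rw [hθs]
      rcases hprev with h | h
      · exact absurd h (Nat.succ_ne_zero t')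
      · simpa using h

end Summit.QuantumAdvantage.QuantumAdvantage.Theorems.MobiusLadderQuadraticDigitPhasesStubStructureA
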